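import Mathlib
import Summits.Ventures.PercRepro2.HCov
import Summits.Ventures.PercRepro2.A3Fibre

/-!
# The a₃-exploration reduction of (HCOV): the worlds and the per-fibre identity
(blind cell PercRepro2, p5 g12; `proofs/P5-A3FIBRE.md` §2, S4 §2.4 (n))

Preparations for `A3FibreMain.HCov_of_a3Between`: the world restrictions of the fibres
`Q ∩ {C(a₃) = W}` (`prob_T_inter` / `prob_T'_inter` / `prob_PD_inter`: the events `T`, `T′`, `PD`
of HCov.lean are the fibres with `a₂ ∈ W`, `a₁ ∈ W`, neither), the fibre masses `Sbo / Sbuo / Suu /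
SbF` of `σ_b σ_o`, `σ_b U_o`, `U_b U_o`, `σ_b F`, and the **per-fibre identity** `slack_div_add`
removing the denominators `m_W` (on a fibre of mass zero every fibre probability vanishes,
`prob_fibre_inter_eq_zero`).
-/

namespace Summit.Ventures.PercRepro2

open UnionCluster

namespace CovForm

namespace A3Fibre

section Worlds

variable {V : Type*} {E : Type*} [Fintype V] [DecidableEq V] [Fintype E] [DecidableEq E]

omit [Fintype V] [DecidableEq V] [Fintype E] [DecidableEq E] in
/-- On `{C(a₃) = W}`, `a₃ ↔ v` iff `v ∈ W`. -/
lemma conn_a3_iff_mem {ends : E → Sym2 V} {a₃ v : V} {W : Finset V} {ω : Config E}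
    (hω : ω ∈ clusterEvent ends a₃ (↑W : Set V)) : Conn ends ω a₃ v ↔ v ∈ W := by
  rw [mem_clusterEvent] at hω
  constructor
  · intro h
    have : v ∈ cluster ends ω a₃ := h
    rw [hω] at this
    exact Finset.mem_coe.1 this
  · intro hv
    have : v ∈ cluster ends ω a₃ := by rw [hω]; exact Finset.mem_coe.2 hv
    exact this

omit [Fintype V] [DecidableEq V] [Fintype E] [DecidableEq E] in
/-- `Q = avoidAll ends a₂ {a₁}` is the complement of `{a₂ ↔ a₁}`. -/
lemma avoidAll_eq_compl (ends : E → Sym2 V) (a₁ a₂ : V) :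
    avoidAll ends a₂ {a₁} = (connEvent ends a₂ a₁)ᶜ := by
  ext ω
  simp only [mem_avoidAll, Finset.mem_singleton, forall_eq, Set.mem_compl_iff, mem_connEvent]

omit [Fintype V] [DecidableEq V] [Fintype E] [DecidableEq E] in
/-- `Q` is also the complement of `{a₁ ↔ a₂}`. -/
lemma avoidAll_eq_compl' (ends : E → Sym2 V) (a₁ a₂ : V) :
    avoidAll ends a₂ {a₁} = (connEvent ends a₁ a₂)ᶜ := by
  ext ω
  simp only [mem_avoidAll, Finset.mem_singleton, forall_eq, Set.mem_compl_iff, mem_connEvent]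
  exact ⟨fun h hc => h (conn_symm hc), fun h hc => h (conn_symm hc)⟩

omit [Fintype V] [Fintype E] [DecidableEq E] in
/-- On the fibre `W`, the event `{a₂ ↔ a₃}` is all or nothing. -/
lemma fibre_inter_conn_a3 (ends : E → Sym2 V) (a₁ a₂ a₃ u : V) (W : Finset V)
    (Y : Set (Config E)) :
    fibre ends a₁ a₂ a₃ W ∩ (connEvent ends u a₃ ∩ Y) =
      if u ∈ W then fibre ends a₁ a₂ a₃ W ∩ Y else ∅ := by
  split_ifs with hu
  · ext ω
    simp only [fibre, Set.mem_inter_iff, mem_connEvent]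
    constructor
    · rintro ⟨hf, _, hY⟩; exact ⟨hf, hY⟩
    · rintro ⟨hf, hY⟩
      exact ⟨hf, conn_symm ((conn_a3_iff_mem hf.2).2 hu), hY⟩
  · ext ω
    simp only [fibre, Set.mem_inter_iff, mem_connEvent, Set.mem_empty_iff_false, iff_false,
      not_and]
    intro hf hc _
    exact hu ((conn_a3_iff_mem hf.2).1 (conn_symm hc))

omit [Fintype V] [Fintype E] [DecidableEq E] in
/-- On the fibre `W`, the event `{a₃ ∉ U}` is all or nothing. -/
lemma fibre_inter_Dtilde (ends : E → Sym2 V) (a₁ a₂ a₃ : V) (W : Finset V)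
    (Y : Set (Config E)) :
    fibre ends a₁ a₂ a₃ W ∩ (Dtilde ends a₁ a₂ a₃ ∩ Y) =
      if a₁ ∉ W ∧ a₂ ∉ W then fibre ends a₁ a₂ a₃ W ∩ Y else ∅ := by
  split_ifs with h
  · ext ω
    simp only [fibre, Set.mem_inter_iff, Dtilde, inU, Set.mem_compl_iff, Set.mem_union,
      mem_connEvent, not_or]
    constructor
    · rintro ⟨hf, _, hY⟩; exact ⟨hf, hY⟩
    · rintro ⟨hf, hY⟩
      exact ⟨hf, ⟨fun hc => h.1 ((conn_a3_iff_mem hf.2).1 hc),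
        fun hc => h.2 ((conn_a3_iff_mem hf.2).1 hc)⟩, hY⟩
  · ext ω
    simp only [fibre, Set.mem_inter_iff, Dtilde, inU, Set.mem_compl_iff, Set.mem_union,
      mem_connEvent, not_or, Set.mem_empty_iff_false, iff_false, not_and]
    intro hf hc _
    apply h
    exact ⟨fun h₁ => hc.1 ((conn_a3_iff_mem hf.2).2 h₁), fun h₂ => hc.2 ((conn_a3_iff_mem hf.2).2 h₂)⟩

variable {R : Type*} [CommRing R]

/-- `P(T ∩ Y) = ∑_{W ∋ a₂} P(fibre W ∩ Y)` (`T = {a₃ ∈ C₂}`). -/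
lemma prob_T_inter (p : E → R) (ends : E → Sym2 V) (a₁ a₂ a₃ : V) (Y : Set (Config E)) :
    prob p (TEvent ends a₁ a₂ a₃ ∩ Y) =
      ∑ W : Finset V, if a₂ ∈ W then prob p (fibre ends a₁ a₂ a₃ W ∩ Y) else 0 := by
  have : TEvent ends a₁ a₂ a₃ ∩ Y = avoidAll ends a₂ {a₁} ∩ (connEvent ends a₂ a₃ ∩ Y) := by
    rw [TEvent, avoidAll_eq_compl, Set.inter_assoc]
  rw [this, ← sum_prob_fibre_inter]
  refine Finset.sum_congr rfl fun W _ => ?_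
  rw [fibre_inter_conn_a3]
  split_ifs <;> simp

/-- `P(T′ ∩ Y) = ∑_{W ∋ a₁} P(fibre W ∩ Y)` (`T′ = {a₃ ∈ C₁}`). -/
lemma prob_T'_inter (p : E → R) (ends : E → Sym2 V) (a₁ a₂ a₃ : V) (Y : Set (Config E)) :
    prob p (TEvent ends a₂ a₁ a₃ ∩ Y) =
      ∑ W : Finset V, if a₁ ∈ W then prob p (fibre ends a₁ a₂ a₃ W ∩ Y) else 0 := by
  have : TEvent ends a₂ a₁ a₃ ∩ Y = avoidAll ends a₂ {a₁} ∩ (connEvent ends a₁ a₃ ∩ Y) := by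
    rw [TEvent, avoidAll_eq_compl', Set.inter_assoc]
  rw [this, ← sum_prob_fibre_inter]
  refine Finset.sum_congr rfl fun W _ => ?_
  rw [fibre_inter_conn_a3]
  split_ifs <;> simp

/-- `P(PD ∩ Y) = ∑_{W ∌ a₁, a₂} P(fibre W ∩ Y)`. -/
lemma prob_PD_inter (p : E → R) (ends : E → Sym2 V) (a₁ a₂ a₃ : V) (Y : Set (Config E)) :
    prob p (PDEvent ends a₁ a₂ a₃ ∩ Y) =
      ∑ W : Finset V, if a₁ ∉ W ∧ a₂ ∉ W then prob p (fibre ends a₁ a₂ a₃ W ∩ Y) else 0 := by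
  have : PDEvent ends a₁ a₂ a₃ ∩ Y = avoidAll ends a₂ {a₁} ∩ (Dtilde ends a₁ a₂ a₃ ∩ Y) := by
    rw [PDEvent, avoidAll_eq_compl', Set.inter_assoc]
  rw [this, ← sum_prob_fibre_inter]
  refine Finset.sum_congr rfl fun W _ => ?_
  rw [fibre_inter_Dtilde]
  split_ifs <;> simp

end Worlds

section PerFibre

variable {V : Type*} {E : Type*} [Fintype V] [DecidableEq V] [Fintype E] [DecidableEq E]
  {R : Type*} [Field R] [LinearOrder R] [IsStrictOrderedRing R]

/-- Mass of `σ_b σ_o` on the fibre. -/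
noncomputable def Sbo (p : E → R) (ends : E → Sym2 V) (a₁ a₂ a₃ b o : V) (W : Finset V) : R :=
  prob p (fibre ends a₁ a₂ a₃ W ∩ (connEvent ends a₁ b ∩ connEvent ends a₁ o)) +
    prob p (fibre ends a₁ a₂ a₃ W ∩ (connEvent ends a₂ b ∩ connEvent ends a₂ o)) -
    prob p (fibre ends a₁ a₂ a₃ W ∩ (connEvent ends a₁ b ∩ connEvent ends a₂ o)) -
    prob p (fibre ends a₁ a₂ a₃ W ∩ (connEvent ends a₂ b ∩ connEvent ends a₁ o))

/-- Mass of `σ_b U_o` on the fibre. -/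
noncomputable def Sbuo (p : E → R) (ends : E → Sym2 V) (a₁ a₂ a₃ b o : V) (W : Finset V) : R :=
  prob p (fibre ends a₁ a₂ a₃ W ∩ (connEvent ends a₁ b ∩ connEvent ends a₁ o)) +
    prob p (fibre ends a₁ a₂ a₃ W ∩ (connEvent ends a₁ b ∩ connEvent ends a₂ o)) -
    prob p (fibre ends a₁ a₂ a₃ W ∩ (connEvent ends a₂ b ∩ connEvent ends a₁ o)) -
    prob p (fibre ends a₁ a₂ a₃ W ∩ (connEvent ends a₂ b ∩ connEvent ends a₂ o))

/-- Mass of `U_b U_o` on the fibre. -/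
noncomputable def Suu (p : E → R) (ends : E → Sym2 V) (a₁ a₂ a₃ b o : V) (W : Finset V) : R :=
  prob p (fibre ends a₁ a₂ a₃ W ∩ (connEvent ends a₁ b ∩ connEvent ends a₁ o)) +
    prob p (fibre ends a₁ a₂ a₃ W ∩ (connEvent ends a₁ b ∩ connEvent ends a₂ o)) +
    prob p (fibre ends a₁ a₂ a₃ W ∩ (connEvent ends a₂ b ∩ connEvent ends a₁ o)) +
    prob p (fibre ends a₁ a₂ a₃ W ∩ (connEvent ends a₂ b ∩ connEvent ends a₂ o))

/-- Mass of `σ_b F` on the fibre. -/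
noncomputable def SbF (p : E → R) (ends : E → Sym2 V) (o a₁ a₂ a₃ b : V) (W : Finset V) : R :=
  Sbo p ends a₁ a₂ a₃ b o W +
    s3 a₁ a₂ W * (gamma p ends o a₁ a₂ a₃ * Ssig p ends a₁ a₂ a₃ b W - Sbuo p ends a₁ a₂ a₃ b o W)

omit [Fintype V] [DecidableEq V] in
/-- On a fibre of mass zero every fibre probability vanishes. -/
lemma prob_fibre_inter_eq_zero {p : E → R} (hp : IsProbVec p) (ends : E → Sym2 V)
    (a₁ a₂ a₃ : V) {W : Finset V} (hm : prob p (fibre ends a₁ a₂ a₃ W) = 0) (X : Set (Config E)) :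
    prob p (fibre ends a₁ a₂ a₃ W ∩ X) = 0 := by
  have h := prob_mono hp (Set.inter_subset_left : fibre ends a₁ a₂ a₃ W ∩ X ⊆ fibre ends a₁ a₂ a₃ W)
  rw [hm] at h
  exact le_antisymm h (prob_nonneg hp _)

omit [Fintype V] in
/-- **The per-fibre identity** removing the denominators. -/
lemma slack_div_add {p : E → R} (hp : IsProbVec p) (ends : E → Sym2 V) (o a₁ a₂ a₃ b : V)
    (W : Finset V) :
    slack p ends o a₁ a₂ a₃ b W / mW p ends a₁ a₂ a₃ W +
        Ssig p ends a₁ a₂ a₃ b W * SF p ends o a₁ a₂ a₃ W / mW p ends a₁ a₂ a₃ W -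
        (if a₁ ∉ W ∧ a₂ ∉ W then
          Su p ends a₁ a₂ a₃ b W * Su p ends a₁ a₂ a₃ o W / mW p ends a₁ a₂ a₃ W else 0) =
      SbF p ends o a₁ a₂ a₃ b W - (if a₁ ∉ W ∧ a₂ ∉ W then Suu p ends a₁ a₂ a₃ b o W else 0) := by
  by_cases hm : mW p ends a₁ a₂ a₃ W = 0
  · have hz := prob_fibre_inter_eq_zero hp ends a₁ a₂ a₃ (by simpa [mW] using hm)
    simp only [slack, SbF, Sbo, Sbuo, Suu, Ssig, Su, SF, mW, hz] at hm ⊢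
    simp [hm]
  · simp only [slack, SbF, Sbo, Sbuo, Suu, Ssig, Su, SF]
    split_ifs <;> field_simp <;> ring

end PerFibre

end A3Fibre

end CovForm

end Summit.Ventures.PercRepro2
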